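import Mathlib
import HarnessLib
import Summits.HubbardSuperconductivity.HubbardSuperconductivity.Theses.ChiralWindow
import Summits.HubbardSuperconductivity.HubbardSuperconductivity.Theorems.ChiralWindowCwChiralConstructionResidual
import Summits.HubbardSuperconductivity.HubbardSuperconductivity.Theorems.ChiralWindowCwChannelInfContinuousFilling
import Summits.HubbardSuperconductivity.HubbardSuperconductivity.Theorems.ChiralWindowCwKLChiralWindowStubKlFillingLower
import Summits.HubbardSuperconductivity.HubbardSuperconductivity.Theorems.ChiralWindowCwChiralConstructionFillingBelowSevenTenths

/-!
# Crux `CwChiralConstruction` (stmt-HubbardSuperconductivity-1740): the ladder-scale transfer, window-robust form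

Route `HubbardSuperconductivity/ChiralWindow`, rank-2 crux ("the programme"). Support file
(`--supports stmt-HubbardSuperconductivity-1740`), line `ladder-scale-transfer`
(`Cruxes/CwChiralConstruction/Lines/ladder_scale_transfer.lean`, lead c4, cycle 2, 2026-08-17).

`Theorems/ChiralWindowCwChiralConstructionLadderTransfer.lean` (p139489) transfers an order floor stated on the
sibling line's LITERAL Grassmann window `ν ∈ [-17/20, -7/20]` to the crux, given the (now landed, p139953) filling
inequality `n(-21/25) < 7/10`. The shared stubs of crux stmt-2010's line `ladder-scale-certified-chain` are still being
re-cut by its lead (record numerals, windows), so this file records the transfer in the form that survives any such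
restatement that keeps the transfer point `μ = -21/25` strictly inside the window:

* `cwChiralConstruction_of_orderFloorOnSubwindow` — an order floor `e^{-C/U²} ≤ dWaveOrderParameter U μ` on ANY open
  operator-side window `(μ₁, μ₂)` with `-111/100 < μ₁ < μ₂ ≤ -21/25`, for all small `U`, implies the crux (free
  fillings there lie strictly inside `(13/25, 7/10)`: `13/25 ≤ n(-111/100) < n(μ₁)` and `n(μ₂) ≤ n(-21/25) < 7/10`,
  both landed; then c1's frame `cwChiralConstruction_of_orderOnOpenSet`, generic-`μ` density).
* `stub_cruxOfOrderFloorOnAnyGrassmannWindow` (registered sub-goal, arrow form) — an order floor read at `μ = ν + U/2`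
  on ANY Grassmann window `[ν₁, ν₂]` with `ν₁ < -21/25 ≤ ν₂`, for all small `U`, implies the crux (take
  `μ₂ := -21/25`, `μ₁ := max ((ν₁ - 21/25)/2) (-1)`, and `U < -21/25 - ν₁` so that `μ - U/2 ∈ [ν₁, ν₂]`).

Fragility, stated plainly: if a future record RAISES the lower end of the Grassmann window above `-21/25`, a new
certified filling inequality `n(μ₂) < 7/10` at some `μ₂ > ν₁` is needed (the octagon bound of p139953 reaches about
`μ₂ ≈ -0.83`; beyond that a finer cover of the Fermi sea is required; `n = 7/10` at `μ ≈ -0.72`).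
No definitions; everything is proved. [folklore: Griffiths 1964 + the cited tree lemmas]
-/

set_option linter.dupNamespace false

namespace Summit.HubbardSuperconductivity.HubbardSuperconductivity.Theorems

open Literature.MathematicalPhysics.QuantumLattice Filter
open Summit.HubbardSuperconductivity.HubbardSuperconductivity.Theses.ChiralWindow
open scoped Topology

/-- **Transfer from any admissible operator-side window.** If `-111/100 < μ₁ < μ₂ ≤ -21/25` and, for every
`U ∈ (0, U₀)`, `e^{-C/U²} ≤ dWaveOrderParameter U μ` for all `μ ∈ (μ₁, μ₂)`, then `CwChiralConstruction`: the free
fillings on `[μ₁, μ₂]` lie in `[13/25 + η, 7/10 - η]` with `η = min (n(μ₁) - 13/25) (7/10 - n(μ₂)) > 0`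
(`stub_klFillingLower`, `strictMonoOn_filling`, `monotone_filling`, `stub_fillingBelowSevenTenths`), and c1's frame
`cwChiralConstruction_of_orderOnOpenSet` applies. [folklore: Griffiths 1964 + landed tree lemmas] -/
theorem cwChiralConstruction_of_orderFloorOnSubwindow {μ₁ μ₂ : ℝ} (h₁ : -111 / 100 < μ₁) (h₁₂ : μ₁ < μ₂)
    (h₂ : μ₂ ≤ -(21:ℝ) / 25)
    (h : ∃ U₀ C : ℝ, 0 < U₀ ∧ 0 < C ∧ ∀ U ∈ Set.Ioo (0:ℝ) U₀,
      ∀ μ ∈ Set.Ioo μ₁ μ₂, Real.exp (-C / U ^ 2) ≤ dWaveOrderParameter U μ) :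
    CwChiralConstruction := by
  obtain ⟨U₀, C, hU₀, hC, H⟩ := h
  -- the free fillings at the two ends of the window
  have hlow : (13 : ℝ) / 25 < KohnLuttinger.filling (squareDispersion 1 0) μ₁ := by
    have hmono := strictMonoOn_filling
      (show (-111 / 100 : ℝ) ∈ Set.Icc (-4 : ℝ) 4 by constructor <;> norm_num)
      (show μ₁ ∈ Set.Icc (-4 : ℝ) 4 by constructor <;> linarith)
      h₁
    exact lt_of_le_of_lt stub_klFillingLower hmono
  have hup : KohnLuttinger.filling (squareDispersion 1 0) μ₂ < 7 / 10 :=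
    lt_of_le_of_lt (monotone_filling h₂) stub_fillingBelowSevenTenths
  set η : ℝ := min (KohnLuttinger.filling (squareDispersion 1 0) μ₁ - 13 / 25)
    (7 / 10 - KohnLuttinger.filling (squareDispersion 1 0) μ₂) with hηdef
  have hη : 0 < η := lt_min (by linarith) (by linarith)
  have hη₁ : η ≤ KohnLuttinger.filling (squareDispersion 1 0) μ₁ - 13 / 25 := min_le_left _ _
  have hη₂ : η ≤ 7 / 10 - KohnLuttinger.filling (squareDispersion 1 0) μ₂ := min_le_right _ _
  refine cwChiralConstruction_of_orderOnOpenSet ⟨η, U₀, C, hη, hU₀, hC, fun U hU => ?_⟩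
  refine ⟨μ₁, μ₂, h₁₂, fun μ hμ => ?_, fun μ hμ => H U hU μ hμ⟩
  have hm1 : KohnLuttinger.filling (squareDispersion 1 0) μ₁ ≤
      KohnLuttinger.filling (squareDispersion 1 0) μ := monotone_filling hμ.1
  have hm2 : KohnLuttinger.filling (squareDispersion 1 0) μ ≤
      KohnLuttinger.filling (squareDispersion 1 0) μ₂ := monotone_filling hμ.2
  exact ⟨by linarith, by linarith⟩

/-- **Registered sub-goal `stub_cruxOfOrderFloorOnAnyGrassmannWindow` — transfer from ANY Grassmann window through
the transfer point.** If `ν₁ < -21/25 ≤ ν₂` and, for every `U ∈ (0, U₀)` and every Grassmann chemical potential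
`ν ∈ [ν₁, ν₂]`, `e^{-C/U²} ≤ dWaveOrderParameter U (ν + U/2)` (the composite conclusion of the shared stubs (K1), (R1),
(B) on whatever window the record ends up with), then `CwChiralConstruction`: with `μ₂ := -21/25`,
`μ₁ := max ((ν₁ - 21/25)/2) (-1)` (so `-111/100 < -1 ≤ μ₁ < μ₂` and `μ₁ - ν₁ ≥ (-21/25 - ν₁)/2 > 0`) and
`U < min U₀ (-21/25 - ν₁)`, every `μ ∈ (μ₁, μ₂)` has `μ - U/2 ∈ [ν₁, ν₂]`, so the floor holds at
`(μ - U/2) + U/2 = μ`; conclude with `cwChiralConstruction_of_orderFloorOnSubwindow`. [folklore] -/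
theorem stub_cruxOfOrderFloorOnAnyGrassmannWindow :
    ∀ ν₁ ν₂ : ℝ, ν₁ < -(21:ℝ) / 25 → -(21:ℝ) / 25 ≤ ν₂ → (∃ U₀ C : ℝ, 0 < U₀ ∧ 0 < C ∧ ∀ U ∈ Set.Ioo (0:ℝ) U₀, ∀ ν ∈ Set.Icc ν₁ ν₂, Real.exp (-C / U ^ 2) ≤ dWaveOrderParameter U (ν + U / 2)) → CwChiralConstruction := by
  rintro ν₁ ν₂ hν₁ hν₂ ⟨U₀, C, hU₀, hC, H⟩
  set μ₁ : ℝ := max ((ν₁ - 21 / 25) / 2) (-1) with hμ₁def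
  have hμ₁a : (ν₁ - 21 / 25) / 2 ≤ μ₁ := le_max_left _ _
  have hμ₁b : (-1 : ℝ) ≤ μ₁ := le_max_right _ _
  have hμ₁lt : μ₁ < -(21:ℝ) / 25 := max_lt (by linarith) (by norm_num)
  have hgap : 0 < -(21:ℝ) / 25 - ν₁ := by linarith
  refine cwChiralConstruction_of_orderFloorOnSubwindow (μ₁ := μ₁) (μ₂ := -(21:ℝ) / 25) (by linarith) hμ₁lt
    le_rfl ⟨min U₀ (-(21:ℝ) / 25 - ν₁), C, lt_min hU₀ hgap, hC, fun U hU μ hμ => ?_⟩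
  have hUU₀ : U < U₀ := lt_of_lt_of_le hU.2 (min_le_left _ _)
  have hUg : U < -(21:ℝ) / 25 - ν₁ := lt_of_lt_of_le hU.2 (min_le_right _ _)
  have hν : μ - U / 2 ∈ Set.Icc ν₁ ν₂ := by
    constructor
    · linarith [hμ.1, hU.1]
    · linarith [hμ.2, hU.1]
  have := H U ⟨hU.1, hUU₀⟩ (μ - U / 2) hν
  rwa [sub_add_cancel] at this

end Summit.HubbardSuperconductivity.HubbardSuperconductivity.Theorems
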